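import Summits.BirchSwinnertonDyer.BirchSwinnertonDyer.Theorems.SignedLowerHalvesSmallImageLowerHalfBothSignsRttCharRoadE1CoefficientEntry
import Mathlib.LinearAlgebra.Basis.VectorSpace
import HarnessLib

/-!
# Route `SignedLowerHalves`, crux L `SmallImageLowerHalfBothSigns` (stmt-BirchSwinnertonDyer-23599), line `rtt_w3` v12 — glue brick §2(c), THE RETRACTION
# (GLUE memo `Lines/rtt_w3-GLUE-g7.md` §2(c)/§5 (iii): «the retraction `ρ : A →+ M` exists because `ρ̄(Γ_{K_m}) = C` has order prime to `p`, so `W_K[p]^J` is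
# semisimple»): MASCHKE'S AVERAGING in the exact currency of brick D3-b (`…RttCharRoadE1CoefficientEntry.exists_injective_classMap`, p764126 — its inputs
# `ρ`, `hρ`, `hρι`).

Width seat `bsd-line-slh-p3-w3` g18 under LEAD `cruxlead-stmt-BirchSwinnertonDyer-23599` (cell `bsd-ssimc`; `--supports stmt-BirchSwinnertonDyer-23599 --as helper`).
THEOREMS ONLY (no definition, no named fact, no instance, no `sorry`); generic group theory / linear algebra. BSD / crux L / INJ_top are NOT proved here.

SETTING (D3-b's): `H ≤ G`, `M`, `A` additive `G`-modules, `S ≤ M` an additive subgroup stable under `H`, `ι : S →+ A` additive `H`-equivariant and INJECTIVE;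
`p` prime with `p · A = 0`, `p · S = 0`; the actions of `H` on `A` and on `S` factor through a homomorphism `q : H →* C` to a finite group whose order is
prime to `p` (`ker q` acts trivially on `A` and on `S`; in the glue `C = kˣ × (𝒪/π)ˣ` or `kˣ`, `q = (Φ ∘ ρ̄, θ̄)`, orders `p² − 1`, `p^f − 1`).
* ★★ `exists_equivariant_retraction` — there is an additive `ρ : A →+ M`, `H`-equivariant, with `ρ (ι s) = s`: an `𝔽_p`-linear retraction `r : A → S`
  (`LinearMap.exists_leftInverse_of_injective`) averaged over the finite image `q(H) ≤ C` along a set-theoretic section `s` —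
  `ρ = u · Σ_{x ∈ q(H)} s(x) · r(s(x)⁻¹ · –)`, `u · #q(H) ≡ 1 (mod p)`; equivariance by reindexing `x ↦ q(h)x` (the defects `s(q(h)x)⁻¹ h s(x)` lie in
  `ker q` and act trivially), retraction since each summand returns `s`.
* ★★ `exists_injective_classMap_of_coprime` — D3-b's packaged injective class map `T → H¹(H, A)`, `[φ] ↦ [ι ∘ φ]`, with the retraction hypothesis
  DISCHARGED by the above (remaining inputs: `hS0`, the `S`-valued representatives `hT`, and the finite prime-to-`p` quotient `q`).

References: [SerreLinearRepresentations1977] §1.3 Thm. 1 (Maschke, averaging proof); [SerreGaloisCohomology1997] I §5.1; [GreenbergVatsal2000] §2 p. 19.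
-/

set_option autoImplicit false
set_option linter.dupNamespace false -- D-0017: single-problem summit, the namespace repeats the problem name by design
noncomputable section

open scoped Classical

universe u

namespace Summit.BirchSwinnertonDyer.BirchSwinnertonDyer.Theorems.SmallImageCharSignedSelmer

open Literature.NumberTheory.EllipticCurves Literature.NumberTheory.GaloisRepresentations

section Maschke

variable {G : Type u} [Group G] {H : Subgroup G}
  {M : Type u} [AddCommGroup M] [DistribMulAction G M]
  {A : Type u} [AddCommGroup A] [DistribMulAction G A]
  (S : AddSubgroup M) (hS : ∀ (x : H) (m : M), m ∈ S → (x : G) • m ∈ S)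
  (ι : S →+ A) (hι : ∀ (x : H) (m : S), ι ⟨(x : G) • (m : M), hS x m m.2⟩ = (x : G) • ι m)

include hι in
/-- ★★ **Maschke's averaging: an `H`-equivariant retraction of an injective equivariant `ι : S → A`** when `p · A = 0`, `p · S = 0` and `H` acts on `A`
and on `S` through a finite group of order prime to `p` (`q : H →* C`, `ker q` acting trivially). Output in the currency of D3-b's `exists_injective_classMap`:
`ρ : A →+ M` additive, `ρ (x • a) = x • ρ a` for `x ∈ H`, `ρ (ι s) = s`. [cite: SerreLinearRepresentations1977, §1.3 Thm. 1] -/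
theorem exists_equivariant_retraction {C : Type*} [Group C] [Finite C] (q : H →* C) {p : ℕ} [hp : Fact p.Prime]
    (hC : ¬ p ∣ Nat.card C) (hpA : ∀ a : A, p • a = 0) (hpS : ∀ m : S, p • m = 0)
    (hqA : ∀ x : H, q x = 1 → ∀ a : A, (x : G) • a = a) (hqS : ∀ x : H, q x = 1 → ∀ m : M, m ∈ S → (x : G) • m = m)
    (hinj : Function.Injective ι) :
    ∃ ρ : A →+ M, (∀ (x : H) (a : A), ρ ((x : G) • a) = (x : G) • ρ a) ∧ ∀ s : S, ρ (ι s) = s := by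
  classical
  -- Step 1: an additive (`𝔽_p`-linear) retraction `r : A → S`
  letI : Module (ZMod p) A := AddCommGroup.zmodModule hpA
  letI : Module (ZMod p) S := AddCommGroup.zmodModule hpS
  obtain ⟨r₀, hr₀⟩ := (ι.toZModLinearMap p).exists_leftInverse_of_injective (LinearMap.ker_eq_bot.2 hinj)
  set r : A →+ S := r₀.toAddMonoidHom with hr
  have hrι : ∀ b : S, r (ι b) = b := fun b ↦ LinearMap.congr_fun hr₀ b
  -- Step 2: the finite image `Q = q(H) ≤ C`, of order prime to `p`, and a section `s`
  set Q : Subgroup C := q.range with hQ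
  haveI : Fintype Q := Fintype.ofFinite Q
  have hsec : ∀ x : Q, ∃ h : H, q h = (x : C) := fun x ↦ MonoidHom.mem_range.1 x.2
  choose s hs using hsec
  have hQp : ¬ p ∣ Fintype.card Q := fun h ↦ hC (h.trans (Nat.card_eq_fintype_card (α := Q) ▸ Subgroup.card_subgroup_dvd_card Q))
  obtain ⟨u, -, hu⟩ := Nat.exists_mul_mod_eq_one_of_coprime ((Nat.Prime.coprime_iff_not_dvd hp.out).2 hQp).symm hp.out.one_lt
  -- the summands and the averaged map
  let F : Q → (A →+ M) := fun x ↦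
    (DistribSMul.toAddMonoidHom M ((s x : H) : G)).comp
      (S.subtype.comp (r.comp (DistribSMul.toAddMonoidHom A (((s x)⁻¹ : H) : G))))
  have hF : ∀ (x : Q) (a : A), F x a = ((s x : H) : G) • ((r ((((s x)⁻¹ : H) : G) • a) : S) : M) := fun x a ↦ rfl
  let ρ₀ : A →+ M := ∑ x : Q, F x
  have hρ₀ : ∀ a : A, ρ₀ a = ∑ x : Q, ((s x : H) : G) • ((r ((((s x)⁻¹ : H) : G) • a) : S) : M) := fun a ↦ by
    rw [AddMonoidHom.finsetSum_apply]
    rfl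
  -- equivariance of `ρ₀`: reindex by `x ↦ q(h) x`; the defects lie in `ker q`
  have hρ₀eq : ∀ (h : H) (a : A), ρ₀ ((h : G) • a) = (h : G) • ρ₀ a := by
    intro h a
    rw [hρ₀, hρ₀, Finset.smul_sum]
    let g : Q := ⟨q h, ⟨h, rfl⟩⟩
    refine (Fintype.sum_equiv (Equiv.mulLeft g)
      (fun x ↦ ((s (g * x) : H) : G) • ((r ((((s (g * x))⁻¹ : H) : G) • ((h : G) • a)) : S) : M))
      (fun x ↦ ((s x : H) : G) • ((r ((((s x)⁻¹ : H) : G) • ((h : G) • a)) : S) : M)) (fun x ↦ rfl)).symm.trans ?_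
    refine Finset.sum_congr rfl fun x _ ↦ ?_
    -- the defect `n = s(g x)⁻¹ h s(x) ∈ ker q`
    set n : H := (s (g * x))⁻¹ * h * s x with hn
    have hqn : q n = 1 := by
      rw [hn, map_mul, map_mul, map_inv, hs, hs, Subgroup.coe_mul]
      change ((q h : C) * (x : C))⁻¹ * q h * (x : C) = 1
      group
    have e1 : (((s (g * x))⁻¹ : H) : G) • ((h : G) • a) = (((s x)⁻¹ : H) : G) • a := by
      rw [smul_smul]
      have e : (((s (g * x))⁻¹ : H) : G) * (h : G) = ((n : H) : G) * (((s x)⁻¹ : H) : G) := by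
        rw [hn]; push_cast; group
      rw [e, ← smul_smul, hqA n hqn]
    have e2 : ∀ m : M, m ∈ S → ((s (g * x) : H) : G) • m = (h : G) • (((s x : H) : G) • m) := by
      intro m hm
      have e : ((s (g * x) : H) : G) = (h : G) * ((s x : H) : G) * (((n⁻¹ : H)) : G) := by
        rw [hn]; push_cast; group
      rw [e, ← smul_smul, ← smul_smul, hqS n⁻¹ (by rw [map_inv, hqn, inv_one]) m hm]
    rw [e1, e2 _ (r _).2]
  -- retraction property of `ρ₀`: each summand returns `s`
  have hρ₀ι : ∀ b : S, ρ₀ (ι b) = Fintype.card Q • (b : M) := by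
    intro b
    rw [hρ₀]
    have e : ∀ x : Q, ((s x : H) : G) • ((r ((((s x)⁻¹ : H) : G) • ι b) : S) : M) = (b : M) := by
      intro x
      rw [← hι ((s x)⁻¹) b, hrι, smul_smul]
      push_cast
      rw [mul_inv_cancel, one_smul]
    simp_rw [e]
    rw [Finset.sum_const, Finset.card_univ]
  -- Step 3: normalise by `u`, `u · #Q ≡ 1 (mod p)`
  refine ⟨AddMonoidHom.mk' (fun a ↦ u • ρ₀ a) (fun a b ↦ by rw [map_add, smul_add]), fun x a ↦ ?_, fun b ↦ ?_⟩
  · change u • ρ₀ ((x : G) • a) = (x : G) • (u • ρ₀ a)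
    rw [hρ₀eq, smul_comm]
  · change u • ρ₀ (ι b) = (b : M)
    rw [hρ₀ι, smul_smul, mul_comm]
    have hpb : p • (b : M) = 0 := by rw [← AddSubgroupClass.coe_nsmul, hpS b, AddSubgroup.coe_zero]
    conv_rhs => rw [← one_smul ℕ (b : M)]
    rw [← Nat.div_add_mod (Fintype.card Q * u) p, hu, add_smul, mul_comm, mul_smul, hpb, smul_zero, zero_add]

end Maschke

section ClassMap

variable {G : Type u} [Group G] [TopologicalSpace G] [IsTopologicalGroup G] {H : Subgroup G}
  {M : Type u} [AddCommGroup M] [DistribMulAction G M] [TopologicalSpace M] [DiscreteTopology M]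
  {A : Type u} [AddCommGroup A] [DistribMulAction G A] [TopologicalSpace A] [DiscreteTopology A]
  (S : AddSubgroup M) (hS : ∀ (x : H) (m : M), m ∈ S → (x : G) • m ∈ S)
  (ι : S →+ A) (hι : ∀ (x : H) (m : S), ι ⟨(x : G) • (m : M), hS x m m.2⟩ = (x : G) • ι m)

include hι in
/-- ★★ **D3-b's injective class map with the retraction DISCHARGED by Maschke**: on any set `T` of classes of `H¹(H, M)` represented by `S`-valued
cocycles there is an injective `Ψ : T → H¹(H, A)` with `Ψ [φ] = [ι ∘ φ]`, provided `ι` is injective, `p · A = 0`, `p · S = 0`, and `H` acts on `A` and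
`S` through a finite group of order prime to `p`. [cite: SerreLinearRepresentations1977, §1.3 Thm. 1] [cite: SerreGaloisCohomology1997, I §5.1] -/
theorem exists_injective_classMap_of_coprime {C : Type*} [Group C] [Finite C] (q : H →* C) {p : ℕ} [Fact p.Prime]
    (hC : ¬ p ∣ Nat.card C) (hpA : ∀ a : A, p • a = 0) (hpS : ∀ m : S, p • m = 0)
    (hqA : ∀ x : H, q x = 1 → ∀ a : A, (x : G) • a = a) (hqS : ∀ x : H, q x = 1 → ∀ m : M, m ∈ S → (x : G) • m = m)
    (hinj : Function.Injective ι)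
    (hS0 : ∀ m : M, (∀ x : H, (x : G) • m - m ∈ S) → ∃ s ∈ S, ∀ x : H, (x : G) • m - m = (x : G) • s - s)
    (T : Set (subgroupH1 H M))
    (hT : ∀ c ∈ T, ∃ φ : contOneCocycles (discreteTopRep H M), oneCocycleClass _ φ = c ∧ ∀ x : H, φ.1 x ∈ S) :
    ∃ Ψ : T → subgroupH1 H A, Function.Injective Ψ ∧
      ∀ (c : T) (φ : contOneCocycles (discreteTopRep H M)) (hφ : ∀ x : H, φ.1 x ∈ S), oneCocycleClass _ φ = (c : subgroupH1 H M) →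
        ∀ ψ : contOneCocycles (discreteTopRep H A), (∀ x : H, ψ.1 x = ι ⟨φ.1 x, hφ x⟩) → Ψ c = oneCocycleClass _ ψ := by
  obtain ⟨ρ, hρ, hρι⟩ := exists_equivariant_retraction S hS ι hι q hC hpA hpS hqA hqS hinj
  exact exists_injective_classMap S hS ι hι hS0 ρ hρ hρι T hT

end ClassMap

end Summit.BirchSwinnertonDyer.BirchSwinnertonDyer.Theorems.SmallImageCharSignedSelmer

end
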